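import Mathlib.Topology.Compactness.Compact
import Literature.AnabelianGeometry.SemiGraphs.TreeFixedPoint

/-!
# Group actions on trees with a finite invariant set (or a finite orbit): a fixed vertex or an
# invariant edge

The classical fact behind [SemiAnbd] Lemma 1.8 (ii)(a) and Theorem 3.7 (iii)/(iv) ("implicit in the
theory of [Serre]", Mochizuki, *Semi-graphs of Anabelioids*, Publ. RIMS **42** (2006), §1 p. 20
[cite: MochizukiSemiAnbd2006, Lem. 1.8(ii)(a) p.20]; Serre, *Trees*, I.4.3 Prop. 19 / I.6.5 Cor. 3):
a family of automorphisms of a tree preserving a finite nonempty set `S` of vertices has a common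
fixed vertex or a common invariant edge (each automorphism fixing or reversing it) — WITHOUT assuming
that `S` spans a subtree. In particular a group acting on a tree with a FINITE ORBIT (e.g. a finite
group, or a compact group acting with open stabilisers) fixes a vertex or stabilises an edge.

This PROOF-ONLY file (no definitions) reduces the general case to abc-iut-L3-t6's
`TreeFixedPoint.exists_fixed_or_invariant_edge` (`TreeFixedPoint.lean`: the case where `T[S]` is
connected) by passing to the GEODESIC HULL of `S`,
`{z | ∃ a ∈ S, ∃ b ∈ S, ∃ p : T.Walk a b, p.IsPath ∧ z ∈ p.support}` (in an acyclic graph the path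
from `a` to `b` is unique, so this is the union of the geodesics between points of `S`):

* `subset_hull`, `hull_finite` (finitely many geodesics, each finite), `hull_connected` (geodesics
  from a hull point to `S` and between points of `S` stay in the hull), `apply_mem_hull` /
  `exists_mem_hull_apply_eq` / `mem_hull_iff_apply_mem_hull` (an injective adjacency-respecting map
  permuting `S` permutes the hull: it maps geodesics to geodesics);
* **`exists_fixed_or_invariant_edge_of_finite_invariant`** — the hull version of t6's theorem (the
  fixed vertex / invariant edge lies in the hull of `S`);
* **`exists_fixed_or_invariant_edge_of_finite_orbit`**, `…_of_finite_group` — a group acting on a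
  (pre)connected acyclic graph by automorphisms with a finite orbit (resp. a finite group) fixes a
  vertex or stabilises an edge.

Everything is phrased, as in `TreeFixedPoint.lean`, for a set `Φ` of maps `V → V` that are injective and
respect adjacency in both directions (resp. an action `act : Γ → V → V` by such maps); `T` is any
acyclic simple graph in which the points of `S` (resp. of the orbit) are mutually reachable. Classical
and undisputed. Requested by abc-iut-L3-lead (ROW L3:TreeFixedPointHull, G10 rung 3:
`CompactInVerticial` of [SemiAnbd] Thm. 3.7 (iii)/(iv)).
-/

namespace Literature.AnabelianGeometry.SemiGraphs

namespace TreeFixedPoint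

open SimpleGraph

universe u

variable {V : Type u} {T : SimpleGraph V}

/-! ## The geodesic hull of a set of vertices (as a set-builder expression; no definition) -/

/-- `S` lies in its geodesic hull (trivial path). [cite: MochizukiSemiAnbd2006, Lem. 1.8(ii)(a) p.20] -/
theorem subset_hull (S : Set V) :
    S ⊆ {z | ∃ a ∈ S, ∃ b ∈ S, ∃ p : T.Walk a b, p.IsPath ∧ z ∈ p.support} :=
  fun z hz => ⟨z, hz, z, hz, Walk.nil, Walk.IsPath.nil, by simp⟩

/-- Every vertex of a path between two points of `S` lies in the hull.
[cite: MochizukiSemiAnbd2006, Lem. 1.8(ii)(a) p.20] -/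
theorem mem_hull_of_mem_support {S : Set V} {a b : V} (ha : a ∈ S) (hb : b ∈ S) {p : T.Walk a b}
    (hp : p.IsPath) {z : V} (hz : z ∈ p.support) :
    z ∈ {z | ∃ a ∈ S, ∃ b ∈ S, ∃ p : T.Walk a b, p.IsPath ∧ z ∈ p.support} :=
  ⟨a, ha, b, hb, p, hp, hz⟩

/-- In an acyclic graph the hull of a finite set is finite (between two vertices there is at most one
path). [cite: MochizukiSemiAnbd2006, Lem. 1.8(ii)(a) p.20] -/
theorem hull_finite (hT : T.IsAcyclic) {S : Set V} (hS : S.Finite) :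
    {z | ∃ a ∈ S, ∃ b ∈ S, ∃ p : T.Walk a b, p.IsPath ∧ z ∈ p.support}.Finite := by
  have hrw : {z | ∃ a ∈ S, ∃ b ∈ S, ∃ p : T.Walk a b, p.IsPath ∧ z ∈ p.support} =
      ⋃ a ∈ S, ⋃ b ∈ S, {z | ∃ p : T.Walk a b, p.IsPath ∧ z ∈ p.support} := by
    ext z
    simp only [Set.mem_setOf_eq, Set.mem_iUnion, exists_prop]
  rw [hrw]
  refine hS.biUnion fun a _ => hS.biUnion fun b _ => ?_
  by_cases hab : Nonempty (T.Path a b)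
  · obtain ⟨p₀⟩ := hab
    refine (p₀.1.support.finite_toSet).subset ?_
    rintro z ⟨p, hp, hz⟩
    have heq : (⟨p, hp⟩ : T.Path a b) = p₀ := hT.path_unique _ _
    rw [← heq]
    exact hz
  · refine Set.finite_empty.subset ?_
    rintro z ⟨p, hp, -⟩
    exact (hab ⟨⟨p, hp⟩⟩).elim

/-- The hull of a nonempty set of mutually reachable vertices induces a connected subgraph: from a hull
point go along its geodesic to an endpoint in `S`, then along a geodesic between points of `S`.
[cite: MochizukiSemiAnbd2006, Lem. 1.8(ii)(a) p.20] -/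
theorem hull_connected {S : Set V} (hne : S.Nonempty) (hreach : ∀ a ∈ S, ∀ b ∈ S, T.Reachable a b) :
    (T.induce {z | ∃ a ∈ S, ∃ b ∈ S, ∃ p : T.Walk a b, p.IsPath ∧ z ∈ p.support}).Connected := by
  classical
  rw [connected_iff]
  refine ⟨?_, ?_⟩
  · rintro ⟨z, a, ha, b, hb, p, hp, hz⟩ ⟨z', a', ha', b', hb', p', hp', hz'⟩
    obtain ⟨q, hq, -⟩ := (hreach b hb a' ha').exists_path_of_dist
    let w : T.Walk z z' := ((p.dropUntil z hz).append q).append (p'.takeUntil z' hz')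
    have hw : ∀ x ∈ w.support,
        x ∈ {z | ∃ a ∈ S, ∃ b ∈ S, ∃ p : T.Walk a b, p.IsPath ∧ z ∈ p.support} := by
      intro x hx
      rcases (Walk.mem_support_append_iff _ _).mp hx with hx | hx
      · rcases (Walk.mem_support_append_iff _ _).mp hx with hx | hx
        · exact ⟨a, ha, b, hb, p, hp, p.support_dropUntil_subset_support hz hx⟩
        · exact ⟨b, hb, a', ha', q, hq, hx⟩
      · exact ⟨a', ha', b', hb', p', hp', p'.support_takeUntil_subset_support hz' hx⟩
    exact ⟨w.induce _ hw⟩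
  · obtain ⟨a, ha⟩ := hne
    exact ⟨⟨a, subset_hull S ha⟩⟩

section Auto

variable {S : Set V} {φ : V → V}

/-- An injective adjacency-respecting map sending `S` into `S` maps the hull into the hull (it maps
paths to paths). [cite: MochizukiSemiAnbd2006, Lem. 1.8(ii)(a) p.20] -/
theorem apply_mem_hull (hinj : Function.Injective φ) (hadj : ∀ x y, T.Adj x y ↔ T.Adj (φ x) (φ y))
    (hS : ∀ x, x ∈ S ↔ φ x ∈ S) {x : V}
    (hx : x ∈ {z | ∃ a ∈ S, ∃ b ∈ S, ∃ p : T.Walk a b, p.IsPath ∧ z ∈ p.support}) :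
    φ x ∈ {z | ∃ a ∈ S, ∃ b ∈ S, ∃ p : T.Walk a b, p.IsPath ∧ z ∈ p.support} := by
  obtain ⟨a, ha, b, hb, p, hp, hxp⟩ := hx
  let f : T →g T := ⟨φ, fun h => (hadj _ _).mp h⟩
  refine ⟨φ a, (hS a).mp ha, φ b, (hS b).mp hb, p.map f, hp.map (f := f) hinj, ?_⟩
  rw [Walk.support_map]
  exact List.mem_map.mpr ⟨x, hxp, rfl⟩

/-- An injective adjacency-respecting map sending `S` ONTO `S` maps the hull onto the hull: the
preimages of the endpoints of a geodesic are joined by a geodesic mapping onto it (uniqueness of paths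
in an acyclic graph). [cite: MochizukiSemiAnbd2006, Lem. 1.8(ii)(a) p.20] -/
theorem exists_mem_hull_apply_eq (hT : T.IsAcyclic) (hreach : ∀ a ∈ S, ∀ b ∈ S, T.Reachable a b)
    (hinj : Function.Injective φ) (hadj : ∀ x y, T.Adj x y ↔ T.Adj (φ x) (φ y))
    (hsurj : ∀ y ∈ S, ∃ x ∈ S, φ x = y) {y : V}
    (hy : y ∈ {z | ∃ a ∈ S, ∃ b ∈ S, ∃ p : T.Walk a b, p.IsPath ∧ z ∈ p.support}) :
    ∃ x ∈ {z | ∃ a ∈ S, ∃ b ∈ S, ∃ p : T.Walk a b, p.IsPath ∧ z ∈ p.support}, φ x = y := by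
  obtain ⟨a, ha, b, hb, q, hq, hyq⟩ := hy
  obtain ⟨a', ha', rfl⟩ := hsurj a ha
  obtain ⟨b', hb', rfl⟩ := hsurj b hb
  obtain ⟨p', hp', -⟩ := (hreach a' ha' b' hb').exists_path_of_dist
  let f : T →g T := ⟨φ, fun h => (hadj _ _).mp h⟩
  have hpath : (p'.map f).IsPath := hp'.map (f := f) hinj
  have heq : q = p'.map f := congrArg Subtype.val (hT.path_unique ⟨q, hq⟩ ⟨p'.map f, hpath⟩)
  rw [heq, Walk.support_map, List.mem_map] at hyq
  obtain ⟨x, hx, rfl⟩ := hyq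
  exact ⟨x, ⟨a', ha', b', hb', p', hp', hx⟩, rfl⟩

/-- Hence such a map satisfies `x ∈ hull ↔ φ x ∈ hull`. [cite: MochizukiSemiAnbd2006, Lem. 1.8(ii)(a) p.20] -/
theorem mem_hull_iff_apply_mem_hull (hT : T.IsAcyclic) (hreach : ∀ a ∈ S, ∀ b ∈ S, T.Reachable a b)
    (hinj : Function.Injective φ) (hadj : ∀ x y, T.Adj x y ↔ T.Adj (φ x) (φ y))
    (hS : ∀ x, x ∈ S ↔ φ x ∈ S) (hsurj : ∀ y ∈ S, ∃ x ∈ S, φ x = y) (x : V) :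
    x ∈ {z | ∃ a ∈ S, ∃ b ∈ S, ∃ p : T.Walk a b, p.IsPath ∧ z ∈ p.support} ↔
      φ x ∈ {z | ∃ a ∈ S, ∃ b ∈ S, ∃ p : T.Walk a b, p.IsPath ∧ z ∈ p.support} := by
  refine ⟨apply_mem_hull hinj hadj hS, fun hx => ?_⟩
  obtain ⟨x', hx', hxx'⟩ := exists_mem_hull_apply_eq hT hreach hinj hadj hsurj hx
  rwa [← hinj hxx']

end Auto

/-! ## The theorems -/

/-- **Fixed vertex or invariant edge for a finite invariant set** (hull form of
`exists_fixed_or_invariant_edge`). Let `T` be an acyclic simple graph, `Φ` a set of maps `V → V` that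
are injective and respect adjacency in both directions, and `S` a finite nonempty set of mutually
reachable vertices mapped onto itself by every `φ ∈ Φ`. Then some vertex of the geodesic hull of `S`
is fixed by all of `Φ`, or some edge with both ends in the hull is fixed or reversed by every `φ ∈ Φ`.
(Serre, *Trees*, I.4.3 / I.6.5; [SemiAnbd] Lemma 1.8 (ii)(a), Thm. 3.7 (iii).)
[cite: MochizukiSemiAnbd2006, Lem. 1.8(ii)(a) p.20] -/
theorem exists_fixed_or_invariant_edge_of_finite_invariant (hT : T.IsAcyclic) (Φ : Set (V → V))
    (hΦ : ∀ φ ∈ Φ, Function.Injective φ ∧ ∀ x y, T.Adj x y ↔ T.Adj (φ x) (φ y))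
    {S : Set V} (hS : S.Finite) (hne : S.Nonempty) (hreach : ∀ a ∈ S, ∀ b ∈ S, T.Reachable a b)
    (hΦS : ∀ φ ∈ Φ, (∀ x, x ∈ S ↔ φ x ∈ S) ∧ (∀ y ∈ S, ∃ x ∈ S, φ x = y)) :
    (∃ x ∈ {z | ∃ a ∈ S, ∃ b ∈ S, ∃ p : T.Walk a b, p.IsPath ∧ z ∈ p.support},
        ∀ φ ∈ Φ, φ x = x) ∨
      (∃ x ∈ {z | ∃ a ∈ S, ∃ b ∈ S, ∃ p : T.Walk a b, p.IsPath ∧ z ∈ p.support},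
        ∃ y ∈ {z | ∃ a ∈ S, ∃ b ∈ S, ∃ p : T.Walk a b, p.IsPath ∧ z ∈ p.support},
          T.Adj x y ∧ ∀ φ ∈ Φ, (φ x = x ∧ φ y = y) ∨ (φ x = y ∧ φ y = x)) := by
  refine exists_fixed_or_invariant_edge hT Φ hΦ _ _ rfl (hull_finite hT hS)
    ⟨hne.some, subset_hull S hne.some_mem⟩ (hull_connected hne hreach) fun φ hφ => ?_
  obtain ⟨hinj, hadj⟩ := hΦ φ hφ
  obtain ⟨hSφ, hsurj⟩ := hΦS φ hφ
  exact ⟨mem_hull_iff_apply_mem_hull hT hreach hinj hadj hSφ hsurj,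
    fun y hy => exists_mem_hull_apply_eq hT hreach hinj hadj hsurj hy⟩

/-- The same with the weaker conclusion "some vertex is fixed, or some edge is fixed or reversed"
(forgetting that they lie in the hull). [cite: MochizukiSemiAnbd2006, Lem. 1.8(ii)(a) p.20] -/
theorem exists_fixed_or_invariant_edge_of_finite_invariant' (hT : T.IsAcyclic) (Φ : Set (V → V))
    (hΦ : ∀ φ ∈ Φ, Function.Injective φ ∧ ∀ x y, T.Adj x y ↔ T.Adj (φ x) (φ y))
    {S : Set V} (hS : S.Finite) (hne : S.Nonempty) (hreach : ∀ a ∈ S, ∀ b ∈ S, T.Reachable a b)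
    (hΦS : ∀ φ ∈ Φ, (∀ x, x ∈ S ↔ φ x ∈ S) ∧ (∀ y ∈ S, ∃ x ∈ S, φ x = y)) :
    (∃ x, ∀ φ ∈ Φ, φ x = x) ∨
      (∃ x y, T.Adj x y ∧ ∀ φ ∈ Φ, (φ x = x ∧ φ y = y) ∨ (φ x = y ∧ φ y = x)) := by
  rcases exists_fixed_or_invariant_edge_of_finite_invariant hT Φ hΦ hS hne hreach hΦS with
    ⟨x, -, hx⟩ | ⟨x, -, y, -, hxy, h⟩
  · exact Or.inl ⟨x, hx⟩
  · exact Or.inr ⟨x, y, hxy, h⟩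

/-- **A group acting on a tree with a finite orbit fixes a vertex or stabilises an edge.** Let `Γ`
act on the vertices of an acyclic simple graph `T` by maps respecting adjacency, and suppose the orbit
of some vertex `v` is finite and consists of mutually reachable vertices (automatic if `T` is
preconnected). Then some vertex is fixed by all of `Γ`, or some edge is fixed or reversed by every
element of `Γ`. (Serre, *Trees*, I.4.3 Prop. 19 / I.6.5; the input of [SemiAnbd] Thm. 3.7 (iii)
`CompactInVerticial`: a compact group acting with open stabilisers has finite orbits.)
[cite: MochizukiSemiAnbd2006, Lem. 1.8(ii)(a) p.20] -/
theorem exists_fixed_or_invariant_edge_of_finite_orbit (hT : T.IsAcyclic) {Γ : Type*} [Group Γ]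
    (act : Γ → V → V) (act_one : ∀ x, act 1 x = x)
    (act_mul : ∀ γ δ x, act (γ * δ) x = act γ (act δ x))
    (act_adj : ∀ γ {x y : V}, T.Adj x y → T.Adj (act γ x) (act γ y)) (v : V)
    (hfin : (Set.range fun γ : Γ => act γ v).Finite)
    (hreach : ∀ γ δ : Γ, T.Reachable (act γ v) (act δ v)) :
    (∃ x, ∀ γ, act γ x = x) ∨
      (∃ x y, T.Adj x y ∧ ∀ γ, (act γ x = x ∧ act γ y = y) ∨ (act γ x = y ∧ act γ y = x)) := by
  have act_inv : ∀ γ x, act γ⁻¹ (act γ x) = x := fun γ x => by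
    rw [← act_mul, inv_mul_cancel, act_one]
  have act_inv' : ∀ γ x, act γ (act γ⁻¹ x) = x := fun γ x => by
    rw [← act_mul, mul_inv_cancel, act_one]
  -- the family of maps and the orbit
  have hΦ : ∀ φ ∈ Set.range act, Function.Injective φ ∧ ∀ x y, T.Adj x y ↔ T.Adj (φ x) (φ y) := by
    rintro _ ⟨γ, rfl⟩
    refine ⟨fun x y h => by simpa [act_inv] using congrArg (act γ⁻¹) h, fun x y => ⟨act_adj γ, ?_⟩⟩
    intro h
    simpa [act_inv] using act_adj γ⁻¹ h
  have hΦS : ∀ φ ∈ Set.range act,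
      (∀ x, x ∈ Set.range (fun γ : Γ => act γ v) ↔ φ x ∈ Set.range (fun γ : Γ => act γ v)) ∧
      (∀ y ∈ Set.range (fun γ : Γ => act γ v), ∃ x ∈ Set.range (fun γ : Γ => act γ v), φ x = y) := by
    rintro _ ⟨γ, rfl⟩
    refine ⟨fun x => ⟨?_, ?_⟩, ?_⟩
    · rintro ⟨δ, rfl⟩
      exact ⟨γ * δ, (act_mul γ δ v).symm ▸ rfl⟩
    · rintro ⟨δ, hδ⟩
      refine ⟨γ⁻¹ * δ, ?_⟩
      change act δ v = act γ x at hδ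
      change act (γ⁻¹ * δ) v = x
      rw [act_mul, hδ, act_inv]
    · rintro _ ⟨δ, rfl⟩
      refine ⟨act (γ⁻¹ * δ) v, ⟨γ⁻¹ * δ, rfl⟩, ?_⟩
      rw [← act_mul, ← mul_assoc, mul_inv_cancel, one_mul]
  have hreach' : ∀ a ∈ Set.range (fun γ : Γ => act γ v), ∀ b ∈ Set.range (fun γ : Γ => act γ v),
      T.Reachable a b := by
    rintro _ ⟨γ, rfl⟩ _ ⟨δ, rfl⟩
    exact hreach γ δ
  rcases exists_fixed_or_invariant_edge_of_finite_invariant' hT (Set.range act) hΦ hfin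
      ⟨act 1 v, 1, rfl⟩ hreach' hΦS with ⟨x, hx⟩ | ⟨x, y, hxy, h⟩
  · exact Or.inl ⟨x, fun γ => hx (act γ) ⟨γ, rfl⟩⟩
  · exact Or.inr ⟨x, y, hxy, fun γ => h (act γ) ⟨γ, rfl⟩⟩

/-- **Finite groups acting on trees** (Serre, *Trees*, I.6.5 Cor. 3; [SemiAnbd] Lemma 1.8 (ii)(a)): a
finite group acting by adjacency-respecting maps on a preconnected acyclic simple graph fixes a vertex
or stabilises an edge (fixing or reversing it). [cite: MochizukiSemiAnbd2006, Lem. 1.8(ii)(a) p.20] -/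
theorem exists_fixed_or_invariant_edge_of_finite_group (hT : T.IsAcyclic) (hc : T.Preconnected)
    {Γ : Type*} [Group Γ] [Finite Γ] [Nonempty V] (act : Γ → V → V) (act_one : ∀ x, act 1 x = x)
    (act_mul : ∀ γ δ x, act (γ * δ) x = act γ (act δ x))
    (act_adj : ∀ γ {x y : V}, T.Adj x y → T.Adj (act γ x) (act γ y)) :
    (∃ x, ∀ γ, act γ x = x) ∨
      (∃ x y, T.Adj x y ∧ ∀ γ, (act γ x = x ∧ act γ y = y) ∨ (act γ x = y ∧ act γ y = x)) := by
  obtain ⟨v⟩ := ‹Nonempty V›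
  exact exists_fixed_or_invariant_edge_of_finite_orbit hT act act_one act_mul act_adj v
    (Set.finite_range _) fun γ δ => hc _ _

/-! ## Appendix (append-only): compact groups acting continuously on a tree -/

/-- **A compact group acting continuously on a tree fixes a vertex or stabilises an edge** — the form in
which [SemiAnbd] Thm. 3.7 (iii) (`CompactInVerticial`) consumes the fixed-point theorem: if `Γ` is a
compact topological group acting by adjacency-respecting maps on the vertices (a discrete set) of an
acyclic simple graph so that the orbit map `γ ↦ γ · v` of some vertex `v` is continuous (⇔ the
stabilisers along the orbit are open), then the orbit of `v` is finite (a compact subset of a discrete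
space), and if its points are mutually reachable (e.g. `T` preconnected) some vertex is fixed by all of
`Γ` or some edge is fixed or reversed by every element of `Γ`. (Serre, *Trees*, I.4.3 / I.6.5.)
[cite: MochizukiSemiAnbd2006, Thm. 3.7(iii) p.40] -/
theorem exists_fixed_or_invariant_edge_of_compact (hT : T.IsAcyclic) {Γ : Type*} [Group Γ]
    [TopologicalSpace Γ] [CompactSpace Γ] [TopologicalSpace V] [DiscreteTopology V]
    (act : Γ → V → V) (act_one : ∀ x, act 1 x = x)
    (act_mul : ∀ γ δ x, act (γ * δ) x = act γ (act δ x))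
    (act_adj : ∀ γ {x y : V}, T.Adj x y → T.Adj (act γ x) (act γ y)) (v : V)
    (hcont : Continuous fun γ : Γ => act γ v)
    (hreach : ∀ γ δ : Γ, T.Reachable (act γ v) (act δ v)) :
    (∃ x, ∀ γ, act γ x = x) ∨
      (∃ x y, T.Adj x y ∧ ∀ γ, (act γ x = x ∧ act γ y = y) ∨ (act γ x = y ∧ act γ y = x)) :=
  exists_fixed_or_invariant_edge_of_finite_orbit hT act act_one act_mul act_adj v
    ((isCompact_range hcont).finite_of_discrete) hreach

/-- The same for a preconnected acyclic graph (reachability automatic).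
[cite: MochizukiSemiAnbd2006, Thm. 3.7(iii) p.40] -/
theorem exists_fixed_or_invariant_edge_of_compact_of_preconnected (hT : T.IsAcyclic)
    (hc : T.Preconnected) {Γ : Type*} [Group Γ] [TopologicalSpace Γ] [CompactSpace Γ]
    [TopologicalSpace V] [DiscreteTopology V]
    (act : Γ → V → V) (act_one : ∀ x, act 1 x = x)
    (act_mul : ∀ γ δ x, act (γ * δ) x = act γ (act δ x))
    (act_adj : ∀ γ {x y : V}, T.Adj x y → T.Adj (act γ x) (act γ y)) (v : V)
    (hcont : Continuous fun γ : Γ => act γ v) :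
    (∃ x, ∀ γ, act γ x = x) ∨
      (∃ x y, T.Adj x y ∧ ∀ γ, (act γ x = x ∧ act γ y = y) ∨ (act γ x = y ∧ act γ y = x)) :=
  exists_fixed_or_invariant_edge_of_compact hT act act_one act_mul act_adj v hcont fun _ _ => hc _ _

end TreeFixedPoint

end Literature.AnabelianGeometry.SemiGraphs
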